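import Literature.MathematicalPhysics.KineticTheory.PhaseSpacePoisson
import Literature.Algebra.Lie.TruncatedLieSeries
import HarnessLib

/-!
# Smooth functions on phase space as a Lie algebra; Proposition 1 of De Roeck–Huveneers, abstract form

`Literature/MathematicalPhysics/KineticTheory/` — the real Lie algebra `C^∞(Ω_N)` of smooth
functions on `PhaseSpace N` under the canonical Poisson bracket (`PhaseSpacePoisson.lean`), and the
specialisation to it of the truncated-Lie-series algebra (`Literature/Algebra/Lie/TruncatedLieSeries.lean`):
the formal canonical transformations `Q = e^{ε^{n}L_{U^{(n)}}} ⋯ e^{εL_{U^{(1)}}}`, `R = Q⁻¹` of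
W. De Roeck, F. Huveneers, CPAM 68 (2015), arXiv:1305.5127, §3.3, and **Proposition 1 (1)–(2)** in
the form "for ANY generators `U^{(1)}, …, U^{(n₁)} ∈ C^∞`":

* `SmoothFun N` (`= C^∞(Ω_N)`, a `LieRing` and `LieAlgebra ℝ` with `⁅f, g⁆ = {f, g}`; Jacobi from
  `poisson_leibniz_lie`);
* `DeRoeckHuveneers2015_prop1_part1`: `R (Q H) = H` ("`H = 𝒯_{n₁}(R H̃)`" with `H̃ := Q H`);
* `DeRoeckHuveneers2015_prop1_part2`: for `H = H^{(0)} + ε H^{(1)}` (`H^{(0)} = D`, `H^{(1)} = V`) and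
  every truncated series `f`,
  `{ev_ε H, ev_ε(R f)} = ev_ε(R (H̃ * f)) + ε^{n₁+1} {H^{(1)}, (R f)^{(n₁)}}`, i.e.
  "`L_H(𝒯_{n₁}(R f)) = 𝒯_{n₁}(R L_{H̃_{n₁}} f) + ε^{n₁+1} L_V ∑_k R^{(n₁-k)} f^{(k)}`".

The CHOICE of the generators (eq. (3.6): `L_D U^{(k)} = (Id - 𝓡)(S^{(k-1)}D + Q^{(k-1)}V)`, which makes
`H̃` resonant) is not made here; it needs the trigonometric-polynomial calculus of §3.1 and is the
subject of later files. All proved, no named facts.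
-/

noncomputable section

open Function Set Finset
open scoped ContDiff

namespace Literature.MathematicalPhysics.KineticTheory.HeatConduction

open Literature.Algebra.Lie Literature.Algebra.Lie.TruncSeries

variable {N : ℕ}

/-! ### `C^∞(Ω_N)` as a real Lie algebra -/

/-- Smooth real functions on phase space, as a submodule of all functions. [folklore] -/
def smoothFun (N : ℕ) : Submodule ℝ (PhaseSpace N → ℝ) where
  carrier := {f | ContDiff ℝ ∞ f}
  add_mem' {f g} hf hg := by
    simp only [Set.mem_setOf_eq] at hf hg ⊢
    exact hf.add hg
  zero_mem' := by
    simp only [Set.mem_setOf_eq]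
    exact contDiff_const
  smul_mem' c f hf := by
    simp only [Set.mem_setOf_eq] at hf ⊢
    exact contDiff_const.smul hf

/-- **`C^∞(Ω_N)`**, the smooth functions on phase space (a type of its own, so that its Lie
bracket is the Poisson bracket and nothing else). [cite: DeRoeckHuveneers2015, §2.2 ("Given two functions `f, g ∈ 𝒞^∞(Ω)`, we define … `L_f g = {f, g}`")] -/
def SmoothFun (N : ℕ) : Type := ↥(smoothFun N)

namespace SmoothFun

/-- Additive group structure (pointwise). [folklore] -/
instance instAddCommGroup : AddCommGroup (SmoothFun N) := inferInstanceAs (AddCommGroup ↥(smoothFun N))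

/-- Real vector space structure (pointwise). [folklore] -/
instance instModule : Module ℝ (SmoothFun N) := inferInstanceAs (Module ℝ ↥(smoothFun N))

/-- The underlying function. [folklore] -/
def val (f : SmoothFun N) : PhaseSpace N → ℝ := (show ↥(smoothFun N) from f).1

/-- Functions of `SmoothFun N` are smooth. [folklore] -/
theorem contDiff (f : SmoothFun N) : ContDiff ℝ ∞ f.val := (show ↥(smoothFun N) from f).2

/-- Functions of `SmoothFun N` are `C²`. [folklore] -/
theorem contDiff_two (f : SmoothFun N) : ContDiff ℝ 2 f.val := f.contDiff.of_le (by norm_cast)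

/-- Functions of `SmoothFun N` are differentiable. [folklore] -/
theorem differentiable (f : SmoothFun N) : Differentiable ℝ f.val := f.contDiff_two.differentiable (by norm_num)

/-- Build an element of `SmoothFun N` from a smooth function. [folklore] -/
def mk (f : PhaseSpace N → ℝ) (hf : ContDiff ℝ ∞ f) : SmoothFun N := (⟨f, hf⟩ : ↥(smoothFun N))

/-- The function of `mk`. [folklore] -/
@[simp] theorem val_mk (f : PhaseSpace N → ℝ) (hf : ContDiff ℝ ∞ f) : (mk f hf).val = f := rfl

/-- Extensionality. [folklore] -/
@[ext] theorem ext {f g : SmoothFun N} (h : f.val = g.val) : f = g := Subtype.ext h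

/-- Function of a sum. [folklore] -/
@[simp] theorem val_add (f g : SmoothFun N) : (f + g).val = f.val + g.val := rfl

/-- Function of zero. [folklore] -/
@[simp] theorem val_zero : (0 : SmoothFun N).val = 0 := rfl

/-- Function of a negative. [folklore] -/
@[simp] theorem val_neg (f : SmoothFun N) : (-f).val = -f.val := rfl

/-- Function of a difference. [folklore] -/
@[simp] theorem val_sub (f g : SmoothFun N) : (f - g).val = f.val - g.val := rfl

/-- Function of a real multiple. [folklore] -/
@[simp] theorem val_smul (c : ℝ) (f : SmoothFun N) : (c • f).val = c • f.val := rfl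

/-- Function of a finite sum. [folklore] -/
theorem val_sum {ι : Type*} (s : Finset ι) (f : ι → SmoothFun N) :
    (∑ i ∈ s, f i).val = fun z => ∑ i ∈ s, (f i).val z := by
  classical
  induction s using Finset.induction_on with
  | empty => rfl
  | insert a s ha ih =>
    rw [sum_insert ha, val_add, ih]
    funext z
    rw [sum_insert ha]
    rfl

/-- The Poisson bracket as the Lie bracket of `C^∞(Ω_N)`. [cite: DeRoeckHuveneers2015, §2.2 eq. (2.4)] -/
instance instBracket : Bracket (SmoothFun N) (SmoothFun N) :=
  ⟨fun f g => mk (poisson f.val g.val) (contDiff_top_poisson f.contDiff g.contDiff)⟩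

/-- The bracket is the Poisson bracket. [folklore] -/
@[simp] theorem val_lie (f g : SmoothFun N) : (⁅f, g⁆ : SmoothFun N).val = poisson f.val g.val := rfl

/-- **`C^∞(Ω_N)` with the Poisson bracket is a Lie ring** (bilinearity, `{f,f} = 0`, and the Jacobi
identity in Leibniz form). [cite: Arnold1989, §40 (C)] -/
instance instLieRing : LieRing (SmoothFun N) where
  add_lie f g h := by
    ext z
    simp only [val_lie, val_add]
    exact poisson_add_left f.differentiable g.differentiable z
  lie_add f g h := by
    ext z
    simp only [val_lie, val_add]
    exact poisson_add_right f.val g.differentiable h.differentiable z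
  lie_self f := by
    ext z
    simp only [val_lie, val_zero]
    exact poisson_self f.val z
  leibniz_lie f g h := by
    ext z
    simp only [val_lie, val_add]
    exact poisson_leibniz_lie f.contDiff_two g.contDiff_two h.contDiff_two z

/-- **`C^∞(Ω_N)` is a real Lie algebra.** [cite: Arnold1989, §40 (C)] -/
instance instLieAlgebra : LieAlgebra ℝ (SmoothFun N) where
  lie_smul c f g := by
    ext z
    simp only [val_lie, val_smul]
    exact poisson_const_mul_right c f.val g.val z

end SmoothFun

/-! ### Proposition 1 of De Roeck–Huveneers for arbitrary generators -/

section Prop1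

variable {n : ℕ}

/-- The function `ev_ε F = ∑_{k ≤ n} ε^k F_k` of a truncated series of smooth functions, pointwise.
[folklore] -/
theorem SmoothFun.val_eval (ε : ℝ) (F : TruncSeries (SmoothFun N) n) (z : PhaseSpace N) :
    (TruncSeries.eval ε F).val z = ∑ k ∈ range (n + 1), ε ^ k * (F.coeff k).val z := by
  unfold TruncSeries.eval
  rw [SmoothFun.val_sum]
  simp only [SmoothFun.val_smul, Pi.smul_apply, smul_eq_mul]

/-- **Proposition 1 (1)** (`H = 𝒯_{n₁}(R H̃)` with `H̃ = 𝒯_{n₁}(Q H)`), for arbitrary smooth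
generators `u 1, …, u m`: `R_m (Q_m H) = H` in `C^∞(Ω_N)[ε]/(ε^{n+1})`.
[cite: DeRoeckHuveneers2015, §3.2 Prop. 1 (1) and §3.3] -/
theorem DeRoeckHuveneers2015_prop1_part1 (u : ℕ → SmoothFun N) (m : ℕ) (H : TruncSeries (SmoothFun N) n) :
    rOp u m (qOp u m H) = H :=
  rOp_qOp u m H

/-- **Proposition 1 (2)** for arbitrary smooth generators: if `H = H^{(0)} + ε H^{(1)}` (`H^{(0)} = D`,
`H^{(1)} = V`, no higher orders) then for every truncated series `f`,
`{ev_ε H, ev_ε (R f)} = ev_ε (R (H̃ * f)) + ε^{n+1} {H^{(1)}, (R f)_n}` with `H̃ = Q H`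
("`L_H(𝒯_{n₁}(R f)) = 𝒯_{n₁}(R L_{H̃_{n₁}} f) + ε^{n₁+1} L_V ∑_{k=0}^{n₁} R^{(n₁-k)} f^{(k)}`").
[cite: DeRoeckHuveneers2015, §3.2 Prop. 1 (2) and §3.3 eq. (3.15)] -/
theorem DeRoeckHuveneers2015_prop1_part2 (hn : 1 ≤ n) (u : ℕ → SmoothFun N) (m : ℕ)
    (H : TruncSeries (SmoothFun N) n) (hH : ∀ k, 2 ≤ k → H.coeff k = 0) (f : TruncSeries (SmoothFun N) n)
    (ε : ℝ) :
    ⁅TruncSeries.eval ε H, TruncSeries.eval ε (rOp u m f)⁆ =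
      TruncSeries.eval ε (rOp u m (qOp u m H * f)) + ε ^ (n + 1) • ⁅H.coeff 1, (rOp u m f).coeff n⁆ := by
  rw [lie_eval_eval_of_coeff_eq_zero ε H (rOp u m f) hn hH, mul_rOp]

/-- Proposition 1 (2), pointwise: with `U_f := ev_ε(R f)`,
`{H_ε, U_f}(z) = ev_ε(R(H̃ * f))(z) + ε^{n+1} {H^{(1)}, (R f)_n}(z)` where `H_ε = ev_ε H = H^{(0)} + εH^{(1)}`.
[cite: DeRoeckHuveneers2015, §3.2 Prop. 1 (2)] -/
theorem DeRoeckHuveneers2015_prop1_part2_apply (hn : 1 ≤ n) (u : ℕ → SmoothFun N) (m : ℕ)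
    (H : TruncSeries (SmoothFun N) n) (hH : ∀ k, 2 ≤ k → H.coeff k = 0) (f : TruncSeries (SmoothFun N) n)
    (ε : ℝ) (z : PhaseSpace N) :
    poisson (TruncSeries.eval ε H).val (TruncSeries.eval ε (rOp u m f)).val z =
      (TruncSeries.eval ε (rOp u m (qOp u m H * f))).val z +
        ε ^ (n + 1) * poisson (H.coeff 1).val ((rOp u m f).coeff n).val z := by
  have h := congrArg (fun g : SmoothFun N => g.val z) (DeRoeckHuveneers2015_prop1_part2 hn u m H hH f ε)
  simpa using h

end Prop1

end Literature.MathematicalPhysics.KineticTheory.HeatConduction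

end
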